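import Literature.NumberTheory.LFunctions.PsiOscillationFromZero
import Literature.NumberTheory.LFunctions.VonKochTheorem
import Literature.NumberTheory.LFunctions.SchoenfeldExplicit
import Literature.NumberTheory.LFunctions.GeneralizedRH
import Literature.Barriers.RiemannHypothesis.LittlewoodOscillationProofs
import HarnessLib

/-!
# `PfPersistenceDilatingLandau` — the LANDAU kernel target of the pub-rhpf cell: one-sided
DILATING ψ-statistics are either unsound for `ζ` or (quasi-)RH-strength

pub-rhpf cell (mechanism/rigidity campaign; no RH claims), seat `pub-rhpf-cand-7` gen 8, CASE-DAG v6 §6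
kernel target LANDAU ("one-sided a-uniform bounds for DILATING linear statistics
`Σ_{n ≤ x} Λ(n) n^{-1/2} K(log n / log x)` that fail off RH are RH-strength (Ω±: Landau 1905; Ingham
Thm 32–34; MV2007 §15)"; leaves G1.11-dilating (Z) and ex-G1.10 dilating one-parameter families).

Everything load-bearing is ALREADY PROVED in the tree's Literature; this file is the cell-facing
DICTIONARY (thin corollaries, kernel-checked, RH-free unless the name says `_of_riemannHypothesis` /
`_iff_`) for the basic dilating statistic `ψ(x) − x` (kernel `K = 1`, weight `Λ(n)`, read at the scale
`x^σ`), in the ONE-SIDED form the cell's (Z)/(U) columns ask about: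

* §1 GRADED ONE-SIDED DICTIONARY (Z column). `re_le_of_psi_oneSided`: a one-sided bound of EITHER sign,
  `η (ψ(x) − x) ≤ A x^σ` eventually (`η = ±1`), forces `Re ρ ≤ σ` for every zero `ρ` of `ζ` with
  `Re ρ > 0`; hence `QuasiRiemannHypothesis σ` (`quasiRiemannHypothesis_of_psi_oneSided`, `σ ≥ 0`) and,
  at `σ = 1/2 + ε` for every `ε > 0`, the Riemann hypothesis (`riemannHypothesis_of_psi_oneSided_eps`).
  Engine: MV Theorem 15.3 in the tree's quantitative zero-wise form
  `Literature.NumberTheory.LFunctions.PsiOscillation.false_of_eventually_le` (Landau's lemma MV 15.1,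
  `Landau.integrableOn_of_differentiableOn_union_convex`, is its engine). This is the one-sided
  strengthening of the tree's two-sided named fact `quasiRiemannHypothesis_of_chebyshevPsi_isBigO`
  (discharged in `VonKochConverse.lean`).
* §2 THE CONVERSE UNDER RH and the RH-EQUIVALENCES. `psi_oneSided_eps_of_riemannHypothesis` (von Koch,
  tree `vonKoch_chebyshevPsi_of_riemannHypothesis_holds`), whence
  `riemannHypothesis_iff_psi_upper_eps : RH ↔ ∀ ε > 0, eventually ψ(x) − x ≤ x^{1/2+ε}` and the mirror
  `riemannHypothesis_iff_psi_lower_eps`; and the EXPLICIT one-sided equivalence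
  `riemannHypothesis_iff_psi_le_schoenfeld : Schoenfeld1976_thm10 → (RH ↔ eventually
  ψ(x) − x ≤ √x (log x − 2) log x / (8π))` (Schoenfeld 1976 Thm 10 under RH for `→`, taken as the
  tree's NAMED FACT `Schoenfeld1976_thm10` — it is DISCHARGED in tree by `Schoenfeld1976_thm10_holds`
  (`SchoenfeldExplicitThm10Proofs.lean`, a `native_decide`-certified computation, hence kept out of
  this file's axiom closure; the companion file `PfPersistenceDilatingLandauExplicit.lean` plugs it in);
  §1 for `←`).
* §3 UNSOUNDNESS AT THE SQUARE-ROOT SCALE (U column, unconditional). By Littlewood's theorem (tree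
  `Literature.Barriers.RiemannHypothesis.LittlewoodOscillation_holds`, `ψ(x) − x = Ω±(√x log log log x)`)
  EVERY one-sided reader `ψ(x) − x ≤ C√x` or `ψ(x) − x ≥ −C√x` (any real `C`, either sign) is violated by
  `ζ` itself for arbitrarily large `x` (`frequently_mul_sqrt_lt_psi_sub`, `frequently_psi_sub_lt_neg_mul_sqrt`,
  `not_eventually_psi_sub_le_mul_rpow_of_le_half`, …): one-sided dilating readers at any scale `A x^σ`,
  `σ ≤ 1/2`, are UNSOUND (not ζ-true), RH or not.

TRICHOTOMY OF RECORD for one-sided readers of `ψ(x) − x` at scale `A x^σ` (all PROVED here from tree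
theorems): `σ ≤ 1/2` ⇒ violated by `ζ` (§3); `σ = 1/2 + ε` for all `ε > 0` (or Schoenfeld's explicit
`√x log² x` gauge) ⇒ EQUIVALENT to RH (§2); fixed `1/2 < σ < 1` ⇒ implies `QuasiRiemannHypothesis σ`
(§1). No scale carries an RH-free sound-and-separating one-sided reader — the LANDAU placement the
CASE-DAG asked for, now with decl names.

POINTERS (in tree, not re-proved here): the dilating RESTRICTED WEIL criterion for one bump is
RH-complete — `Summit.RiemannHypothesis.RiemannHypothesis.Theorems.WeilCombBohrFejer.stub_dilationDetection`
(`(∀ ε ≥ 1, 0 ≤ Re W(φ_ε ⋆ φ̃_ε)) → RiemannHypothesis`, five files `WeilCombCombShapePositivityStubDilation*`,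
Landau's lemma in the dilation variable + the Plemelj jump across the least-angle cut); Suzuki's screw
criterion `riemannHypothesis_of_zetaScrew_nonneg` / `Suzuki2023_thm17_holds` (a one-sided dilating
`Λ`-statistic with kernel `(t − log n)₊`); one-sided Mertens / Liouville / Turán sums ⇒ RH
(`MertensOneSided`, `LiouvilleOneSidedRH.riemannHypothesis_of_liouvilleSum_oneSided`, `TuranOneSided`).

References: Montgomery–Vaughan, *Multiplicative Number Theory I* (CUP 2007) §15.1 Lemma 15.1,
Thm 15.2, Thm 15.3, Cor 15.4, Thm 15.11, Thm 13.1; L. Schoenfeld, Math. Comp. 30 (1976) Thm 10.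
-/

noncomputable section

-- the sub-problem path RiemannHypothesis/RiemannHypothesis duplicates a namespace (D-0017)
set_option linter.dupNamespace false

open Filter Asymptotics Real
open scoped Topology Chebyshev

namespace Summit.RiemannHypothesis.RiemannHypothesis.Theorems.PfPersistenceDilatingLandau

open Literature.NumberTheory.LFunctions
open Literature.Barriers.RiemannHypothesis

/-! ## §1 The graded one-sided dictionary (MV Thm 15.3 ⇒ one-sided bounds bound the zeros' abscissae) -/

/-- **One-sided bound at scale `x^σ` ⇒ no zero to the right of `σ`.** If for a sign `η = ±1` and some
`A` the one-sided bound `η (ψ(x) − x) ≤ A x^σ` holds for all large `x`, then every zero `ρ` of `ζ`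
with `Re ρ > 0` has `Re ρ ≤ σ`. (A zero with `Re ρ > σ` would make `η(ψ(x) − x) > c x^{Re ρ}` for
arbitrarily large `x` for every `c < 1/|ρ|`, MV Thm 15.3, while `A x^σ ≤ c x^{Re ρ}` eventually.)
[cite: MontgomeryVaughan2007, Thm. 15.3] -/
theorem re_le_of_psi_oneSided {η A σ : ℝ} (hη : η = 1 ∨ η = -1)
    (hev : ∀ᶠ x in atTop, η * (ψ x - x) ≤ A * x ^ σ)
    {ρ : ℂ} (h0 : riemannZeta ρ = 0) (hre : 0 < ρ.re) : ρ.re ≤ σ := by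
  refine not_lt.1 fun hlt ↦ ?_
  have hρ0 : ρ ≠ 0 := by
    rintro rfl
    simp at hre
  have hn : 0 < ‖ρ‖ := norm_pos_iff.2 hρ0
  have hinv : 0 < 1 / ‖ρ‖ := one_div_pos.2 hn
  set c : ℝ := 1 / ‖ρ‖ / 2 with hcdef
  have hc0 : 0 < c := by positivity
  have hc : c < 1 / ‖ρ‖ := by rw [hcdef]; linarith
  refine PsiOscillation.false_of_eventually_le h0 hre hη hc0 hc ?_
  have hε : 0 < ρ.re - σ := sub_pos.2 hlt
  have ht : Tendsto (fun x : ℝ ↦ x ^ (ρ.re - σ)) atTop atTop := tendsto_rpow_atTop hε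
  filter_upwards [hev, ht.eventually_ge_atTop (A / c), eventually_gt_atTop 0] with x h1 h2 hx
  refine h1.trans ?_
  have hA : A ≤ c * x ^ (ρ.re - σ) := by rw [mul_comm]; exact (div_le_iff₀ hc0).1 h2
  have hxσ : 0 ≤ x ^ σ := (Real.rpow_pos_of_pos hx σ).le
  calc A * x ^ σ ≤ c * x ^ (ρ.re - σ) * x ^ σ := mul_le_mul_of_nonneg_right hA hxσ
    _ = c * x ^ ρ.re := by rw [mul_assoc, ← Real.rpow_add hx, sub_add_cancel]

/-- **One-sided floor/ceiling at scale `x^σ` ⇒ quasi-RH(σ)** (`σ ≥ 0`): `ζ` has no zeros with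
`σ < Re s < 1`. The one-sided strengthening of the tree's (two-sided) named fact
`quasiRiemannHypothesis_of_chebyshevPsi_isBigO`. [cite: MontgomeryVaughan2007, §15.1 and Thm. 15.3] -/
theorem quasiRiemannHypothesis_of_psi_oneSided {η A σ : ℝ} (hη : η = 1 ∨ η = -1) (hσ : 0 ≤ σ)
    (hev : ∀ᶠ x in atTop, η * (ψ x - x) ≤ A * x ^ σ) : QuasiRiemannHypothesis σ :=
  fun _s hs hσs _h1 ↦ (not_lt.2 (re_le_of_psi_oneSided hη hev hs (hσ.trans_lt hσs))) hσs

/-- **One-sided `x^{1/2+ε}` bounds for every `ε > 0` ⇒ RH** (either sign). [cite: MontgomeryVaughan2007, §15.1 and Thm. 15.3] -/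
theorem riemannHypothesis_of_psi_oneSided_eps {η : ℝ} (hη : η = 1 ∨ η = -1)
    (h : ∀ ε : ℝ, 0 < ε → ∀ᶠ x in atTop, η * (ψ x - x) ≤ x ^ (1 / 2 + ε)) : RiemannHypothesis := by
  refine quasiRiemannHypothesis_one_half_iff_holds.mp fun s hs h1 _h2 ↦ ?_
  have hε : 0 < (s.re - 1 / 2) / 2 := by linarith
  have hev : ∀ᶠ x in atTop, η * (ψ x - x) ≤ 1 * x ^ (1 / 2 + (s.re - 1 / 2) / 2) := by
    simpa only [one_mul] using h _ hε
  have := re_le_of_psi_oneSided hη hev hs (by linarith)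
  linarith

/-! ## §2 The converse under RH (von Koch; Schoenfeld) and the one-sided RH-equivalences -/

/-- Under RH, `|ψ(x) − x| ≤ x^{1/2+ε}` eventually, for every `ε > 0` (von Koch's
`O(x^{1/2} log² x)`, tree `vonKoch_chebyshevPsi_of_riemannHypothesis_holds`, and `log² x = o(x^ε)`).
[cite: MontgomeryVaughan2007, Thm. 13.1] -/
theorem abs_psi_sub_le_rpow_of_riemannHypothesis (hRH : RiemannHypothesis) {ε : ℝ} (hε : 0 < ε) :
    ∀ᶠ x in atTop, |ψ x - x| ≤ x ^ (1 / 2 + ε) := by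
  have hK := vonKoch_chebyshevPsi_of_riemannHypothesis_holds hRH
  have hlog : (fun x : ℝ ↦ Real.log x ^ 2) =o[atTop] fun x ↦ x ^ ε := by
    simpa only [Real.rpow_two] using isLittleO_log_rpow_rpow_atTop (2 : ℝ) hε
  have hprod : (fun x : ℝ ↦ x ^ (1 / 2 : ℝ) * Real.log x ^ 2) =o[atTop]
      fun x ↦ x ^ (1 / 2 : ℝ) * x ^ ε :=
    (isBigO_refl (fun x : ℝ ↦ x ^ (1 / 2 : ℝ)) atTop).mul_isLittleO hlog
  have h := (hK.trans_isLittleO hprod).def zero_lt_one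
  filter_upwards [h, eventually_gt_atTop 0] with x hx hx0
  have hnn : 0 ≤ x ^ (1 / 2 : ℝ) * x ^ ε :=
    mul_nonneg (Real.rpow_nonneg hx0.le _) (Real.rpow_nonneg hx0.le _)
  rw [Real.norm_eq_abs, one_mul, Real.norm_eq_abs, abs_of_nonneg hnn, ← Real.rpow_add hx0] at hx
  exact hx

/-- Under RH, the one-sided bounds `η (ψ(x) − x) ≤ x^{1/2+ε}` hold eventually for each sign and
every `ε > 0`. [cite: MontgomeryVaughan2007, Thm. 13.1] -/
theorem psi_oneSided_eps_of_riemannHypothesis (hRH : RiemannHypothesis) {η : ℝ} (hη : η = 1 ∨ η = -1)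
    {ε : ℝ} (hε : 0 < ε) : ∀ᶠ x in atTop, η * (ψ x - x) ≤ x ^ (1 / 2 + ε) := by
  filter_upwards [abs_psi_sub_le_rpow_of_riemannHypothesis hRH hε] with x hx
  rcases hη with rfl | rfl
  · rw [one_mul]; exact (le_abs_self _).trans hx
  · rw [neg_one_mul]; exact (neg_le_abs _).trans hx

/-- **RH ⟺ the one-sided UPPER `x^{1/2+ε}` bounds for all `ε > 0`.** [cite: MontgomeryVaughan2007, Thm. 13.1 and Thm. 15.3] -/
theorem riemannHypothesis_iff_psi_upper_eps :
    RiemannHypothesis ↔ ∀ ε : ℝ, 0 < ε → ∀ᶠ x in atTop, ψ x - x ≤ x ^ (1 / 2 + ε) := by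
  constructor
  · intro hRH ε hε
    simpa only [one_mul] using psi_oneSided_eps_of_riemannHypothesis hRH (Or.inl rfl) hε
  · intro h
    exact riemannHypothesis_of_psi_oneSided_eps (η := 1) (Or.inl rfl) (by simpa only [one_mul] using h)

/-- **RH ⟺ the one-sided LOWER `x^{1/2+ε}` bounds for all `ε > 0`.** [cite: MontgomeryVaughan2007, Thm. 13.1 and Thm. 15.3] -/
theorem riemannHypothesis_iff_psi_lower_eps :
    RiemannHypothesis ↔ ∀ ε : ℝ, 0 < ε → ∀ᶠ x in atTop, -(x ^ (1 / 2 + ε)) ≤ ψ x - x := by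
  constructor
  · intro hRH ε hε
    filter_upwards [psi_oneSided_eps_of_riemannHypothesis hRH (Or.inr rfl) hε] with x hx
    rw [neg_one_mul] at hx
    linarith
  · intro h
    refine riemannHypothesis_of_psi_oneSided_eps (η := -1) (Or.inr rfl) fun ε hε ↦ ?_
    filter_upwards [h ε hε] with x hx
    rw [neg_one_mul]
    linarith

/-- Schoenfeld's explicit RH-bound is eventually below `x^{1/2+ε}`:
`√x (log x − 2) log x / (8π) ≤ x^{1/2+ε}` for all large `x`. [cite: Schoenfeld1976, Thm. 10 (6.1)] -/
theorem schoenfeldGauge_le_rpow {ε : ℝ} (hε : 0 < ε) :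
    ∀ᶠ x in atTop, √x * (Real.log x - 2) * Real.log x / (8 * π) ≤ x ^ (1 / 2 + ε) := by
  have hlog : (fun x : ℝ ↦ Real.log x ^ 2) =o[atTop] fun x ↦ x ^ ε := by
    simpa only [Real.rpow_two] using isLittleO_log_rpow_rpow_atTop (2 : ℝ) hε
  filter_upwards [hlog.def zero_lt_one, eventually_ge_atTop (Real.exp 2)] with x hx hx2
  have hx0 : 0 < x := (Real.exp_pos 2).trans_le hx2
  have hl2 : 2 ≤ Real.log x := by
    rw [← Real.log_exp 2]; exact Real.log_le_log (Real.exp_pos 2) hx2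
  have hl0 : 0 ≤ Real.log x := by linarith
  rw [Real.norm_eq_abs, abs_of_nonneg (pow_nonneg hl0 2), one_mul, Real.norm_eq_abs,
    abs_of_nonneg (Real.rpow_nonneg hx0.le _)] at hx
  -- hx : log x ^ 2 ≤ x ^ ε
  have hsqrt : √x = x ^ (1 / 2 : ℝ) := Real.sqrt_eq_rpow x
  have hr : 0 ≤ x ^ (1 / 2 : ℝ) := Real.rpow_nonneg hx0.le _
  have hπ : (1 : ℝ) ≤ 8 * π := by nlinarith [Real.pi_gt_three]
  have hnum : 0 ≤ (Real.log x - 2) * Real.log x := mul_nonneg (by linarith) hl0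
  have hmain : (Real.log x - 2) * Real.log x ≤ x ^ ε := by
    have : (Real.log x - 2) * Real.log x ≤ Real.log x ^ 2 := by nlinarith
    exact this.trans hx
  calc √x * (Real.log x - 2) * Real.log x / (8 * π)
      = x ^ (1 / 2 : ℝ) * ((Real.log x - 2) * Real.log x) / (8 * π) := by rw [hsqrt]; ring
    _ ≤ x ^ (1 / 2 : ℝ) * ((Real.log x - 2) * Real.log x) / 1 :=
        div_le_div_of_nonneg_left (mul_nonneg hr hnum) one_pos hπ
    _ ≤ x ^ (1 / 2 : ℝ) * x ^ ε := by rw [div_one]; exact mul_le_mul_of_nonneg_left hmain hr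
    _ = x ^ (1 / 2 + ε) := by rw [← Real.rpow_add hx0]

/-- **RH ⟺ Schoenfeld's explicit ONE-SIDED bound eventually** (given the tree's named fact
`Schoenfeld1976_thm10`, discharged in tree by `Schoenfeld1976_thm10_holds`):
`RH ↔ ∀ᶠ x, ψ(x) − x ≤ √x (log x − 2) log x / (8π)`. (`→`: Schoenfeld 1976 Thm 10 under RH, for
`x ≥ 23·10⁸`; `←`: the gauge is `≤ x^{1/2+ε}` eventually, then §1.) [cite: Schoenfeld1976, Thm. 10 (6.1)] -/
theorem riemannHypothesis_iff_psi_le_schoenfeld (h10 : Schoenfeld1976_thm10) :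
    RiemannHypothesis ↔
      ∀ᶠ x in atTop, ψ x - x ≤ √x * (Real.log x - 2) * Real.log x / (8 * π) := by
  constructor
  · intro hRH
    filter_upwards [eventually_ge_atTop (23 * 10 ^ 8 : ℝ)] with x hx
    exact (le_abs_self _).trans (h10 hRH x hx).1.le
  · intro h
    refine riemannHypothesis_iff_psi_upper_eps.2 fun ε hε ↦ ?_
    filter_upwards [h, schoenfeldGauge_le_rpow hε] with x h1 h2 using h1.trans h2

/-- The mirror (given `Schoenfeld1976_thm10`): `RH ↔ ∀ᶠ x, −√x (log x − 2) log x / (8π) ≤ ψ(x) − x`.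
[cite: Schoenfeld1976, Thm. 10 (6.1)] -/
theorem riemannHypothesis_iff_schoenfeld_le_psi (h10 : Schoenfeld1976_thm10) :
    RiemannHypothesis ↔
      ∀ᶠ x in atTop, -(√x * (Real.log x - 2) * Real.log x / (8 * π)) ≤ ψ x - x := by
  constructor
  · intro hRH
    filter_upwards [eventually_ge_atTop (23 * 10 ^ 8 : ℝ)] with x hx
    exact (neg_le_neg (h10 hRH x hx).1.le).trans (neg_abs_le _)
  · intro h
    refine riemannHypothesis_iff_psi_lower_eps.2 fun ε hε ↦ ?_
    filter_upwards [h, schoenfeldGauge_le_rpow hε] with x h1 h2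
    linarith

/-- The `←` halves need no named fact: **an eventual one-sided Schoenfeld-gauge bound (either side)
implies RH**, unconditionally. [cite: MontgomeryVaughan2007, Thm. 15.3] -/
theorem riemannHypothesis_of_psi_le_schoenfeld
    (h : ∀ᶠ x in atTop, ψ x - x ≤ √x * (Real.log x - 2) * Real.log x / (8 * π)) :
    RiemannHypothesis :=
  riemannHypothesis_iff_psi_upper_eps.2 fun ε hε ↦ by
    filter_upwards [h, schoenfeldGauge_le_rpow hε] with x h1 h2 using h1.trans h2

/-- Mirror of `riemannHypothesis_of_psi_le_schoenfeld`. [cite: MontgomeryVaughan2007, Thm. 15.3] -/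
theorem riemannHypothesis_of_schoenfeld_le_psi
    (h : ∀ᶠ x in atTop, -(√x * (Real.log x - 2) * Real.log x / (8 * π)) ≤ ψ x - x) :
    RiemannHypothesis :=
  riemannHypothesis_iff_psi_lower_eps.2 fun ε hε ↦ by
    filter_upwards [h, schoenfeldGauge_le_rpow hε] with x h1 h2
    linarith

/-! ## §3 Unsoundness of every square-root-scale one-sided reader (Littlewood; unconditional) -/

/-- **`ψ(x) − x > C√x` for arbitrarily large `x`, for EVERY real `C`** (unconditional; Littlewood's
`Ω₊(√x log log log x)`, tree `LittlewoodOscillation_holds`). [cite: MontgomeryVaughan2007, Thm. 15.11 (15.22)] -/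
theorem frequently_mul_sqrt_lt_psi_sub (C : ℝ) :
    ∃ᶠ x in atTop, C * x ^ (1 / 2 : ℝ) < ψ x - x := by
  obtain ⟨c, hc, hfreq⟩ := LittlewoodOscillation_holds.1.1
  have hev : ∀ᶠ x in atTop, C / c < littlewoodGaugePsi x / x ^ (1 / 2 : ℝ) :=
    tendsto_littlewoodGaugePsi_div_sqrt.eventually_gt_atTop _
  refine (hfreq.and_eventually (hev.and (eventually_gt_atTop 0))).mono fun x hx ↦ ?_
  obtain ⟨hle, hgt, hx0⟩ := hx
  have hle' : c * littlewoodGaugePsi x ≤ ψ x - x := hle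
  have hxr : 0 < x ^ (1 / 2 : ℝ) := Real.rpow_pos_of_pos hx0 _
  rw [div_lt_div_iff₀ hc hxr] at hgt
  have hcomm : littlewoodGaugePsi x * c = c * littlewoodGaugePsi x := mul_comm _ _
  linarith

/-- **`ψ(x) − x < −C√x` for arbitrarily large `x`, for EVERY real `C`** (unconditional; Littlewood's
`Ω₋`). [cite: MontgomeryVaughan2007, Thm. 15.11 (15.22)] -/
theorem frequently_psi_sub_lt_neg_mul_sqrt (C : ℝ) :
    ∃ᶠ x in atTop, ψ x - x < -(C * x ^ (1 / 2 : ℝ)) := by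
  obtain ⟨c, hc, hfreq⟩ := LittlewoodOscillation_holds.1.2
  have hev : ∀ᶠ x in atTop, C / c < littlewoodGaugePsi x / x ^ (1 / 2 : ℝ) :=
    tendsto_littlewoodGaugePsi_div_sqrt.eventually_gt_atTop _
  refine (hfreq.and_eventually (hev.and (eventually_gt_atTop 0))).mono fun x hx ↦ ?_
  obtain ⟨hle, hgt, hx0⟩ := hx
  have hle' : ψ x - x ≤ -(c * littlewoodGaugePsi x) := hle
  have hxr : 0 < x ^ (1 / 2 : ℝ) := Real.rpow_pos_of_pos hx0 _
  rw [div_lt_div_iff₀ hc hxr] at hgt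
  have hcomm : littlewoodGaugePsi x * c = c * littlewoodGaugePsi x := mul_comm _ _
  linarith

/-- **No one-sided reader at scale `A x^σ`, `σ ≤ 1/2`, is `ζ`-true (upper side).** For every `A` and
every `σ ≤ 1/2`, `ψ(x) − x ≤ A x^σ` FAILS for arbitrarily large `x` — the (U)-column word for one-sided
dilating `ψ`-readers at or below the square-root scale: UNSOUND, unconditionally.
[cite: MontgomeryVaughan2007, Thm. 15.11 (15.22)] -/
theorem not_eventually_psi_sub_le_mul_rpow_of_le_half (A : ℝ) {σ : ℝ} (hσ : σ ≤ 1 / 2) :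
    ¬ ∀ᶠ x in atTop, ψ x - x ≤ A * x ^ σ := by
  intro h
  have hdom : ∀ᶠ x in atTop, A * x ^ σ ≤ |A| * x ^ (1 / 2 : ℝ) := by
    filter_upwards [eventually_ge_atTop 1] with x hx
    have hx0 : 0 < x := by linarith
    calc A * x ^ σ ≤ |A| * x ^ σ := mul_le_mul_of_nonneg_right (le_abs_self A) (Real.rpow_nonneg hx0.le σ)
      _ ≤ |A| * x ^ (1 / 2 : ℝ) :=
          mul_le_mul_of_nonneg_left (Real.rpow_le_rpow_of_exponent_le hx hσ) (abs_nonneg A)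
  obtain ⟨x, hlt, h1, h2⟩ := ((frequently_mul_sqrt_lt_psi_sub |A|).and_eventually (h.and hdom)).exists
  linarith

/-- **No one-sided reader at scale `A x^σ`, `σ ≤ 1/2`, is `ζ`-true (lower side).** For every `A` and
every `σ ≤ 1/2`, `−A x^σ ≤ ψ(x) − x` FAILS for arbitrarily large `x`. [cite: MontgomeryVaughan2007, Thm. 15.11 (15.22)] -/
theorem not_eventually_neg_mul_rpow_le_psi_sub_of_le_half (A : ℝ) {σ : ℝ} (hσ : σ ≤ 1 / 2) :
    ¬ ∀ᶠ x in atTop, -(A * x ^ σ) ≤ ψ x - x := by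
  intro h
  have hdom : ∀ᶠ x in atTop, A * x ^ σ ≤ |A| * x ^ (1 / 2 : ℝ) := by
    filter_upwards [eventually_ge_atTop 1] with x hx
    have hx0 : 0 < x := by linarith
    calc A * x ^ σ ≤ |A| * x ^ σ := mul_le_mul_of_nonneg_right (le_abs_self A) (Real.rpow_nonneg hx0.le σ)
      _ ≤ |A| * x ^ (1 / 2 : ℝ) :=
          mul_le_mul_of_nonneg_left (Real.rpow_le_rpow_of_exponent_le hx hσ) (abs_nonneg A)
  obtain ⟨x, hlt, h1, h2⟩ :=
    ((frequently_psi_sub_lt_neg_mul_sqrt |A|).and_eventually (h.and hdom)).exists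
  linarith

/-- **The one-sided `x^σ` readers for `σ ≤ 1/2` are unsound in the signed form of §1 as well**:
for `η = ±1`, `A` real and `σ ≤ 1/2`, `η (ψ(x) − x) ≤ A x^σ` fails for arbitrarily large `x`.
[cite: MontgomeryVaughan2007, Thm. 15.11 (15.22)] -/
theorem not_eventually_psi_oneSided_of_le_half {η : ℝ} (hη : η = 1 ∨ η = -1) (A : ℝ) {σ : ℝ}
    (hσ : σ ≤ 1 / 2) : ¬ ∀ᶠ x in atTop, η * (ψ x - x) ≤ A * x ^ σ := by
  rcases hη with rfl | rfl
  · simpa only [one_mul] using not_eventually_psi_sub_le_mul_rpow_of_le_half A hσ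
  · intro h
    refine not_eventually_neg_mul_rpow_le_psi_sub_of_le_half A hσ ?_
    filter_upwards [h] with x hx
    rw [neg_one_mul] at hx
    linarith

/-! ## §4 The trichotomy packaged (for the cell's GAP-CLASSES row; all three clauses are the theorems above) -/

/-- **TRICHOTOMY for one-sided dilating `ψ`-readers at scale `A x^σ`** (`η = ±1`):
(i) `σ ≤ 1/2`: the reader is violated by `ζ` (unconditional); (ii) at `σ = 1/2 + ε` for all `ε > 0`
the reader (constant `1`) is EQUIVALENT to RH; (iii) for `0 ≤ σ` the reader implies
`QuasiRiemannHypothesis σ`. [cite: MontgomeryVaughan2007, §15.1 (Thm. 15.3, Thm. 15.11) and Thm. 13.1] -/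
theorem psi_oneSided_trichotomy {η : ℝ} (hη : η = 1 ∨ η = -1) :
    (∀ A σ : ℝ, σ ≤ 1 / 2 → ¬ ∀ᶠ x in atTop, η * (ψ x - x) ≤ A * x ^ σ) ∧
    (RiemannHypothesis ↔ ∀ ε : ℝ, 0 < ε → ∀ᶠ x in atTop, η * (ψ x - x) ≤ x ^ (1 / 2 + ε)) ∧
    (∀ A σ : ℝ, 0 ≤ σ → (∀ᶠ x in atTop, η * (ψ x - x) ≤ A * x ^ σ) → QuasiRiemannHypothesis σ) := by
  refine ⟨fun A σ hσ ↦ not_eventually_psi_oneSided_of_le_half hη A hσ, ⟨?_, ?_⟩,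
    fun A σ hσ hev ↦ quasiRiemannHypothesis_of_psi_oneSided hη hσ hev⟩
  · intro hRH ε hε
    exact psi_oneSided_eps_of_riemannHypothesis hRH hη hε
  · exact riemannHypothesis_of_psi_oneSided_eps hη

end Summit.RiemannHypothesis.RiemannHypothesis.Theorems.PfPersistenceDilatingLandau
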